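import Summits.CriticalPhenomena.PercolationContinuityZ3.Theorems.PercNearOneGluingNoHeavyLowerTailSahiAtLeastOneCert

/-!
# `NoHeavyLowerTail` (crux stmt-CriticalPhenomena-4575), P3 lane: COMPLEMENT DUALITY AT EVERY LEVEL — the open-language form `M_t(𝒳,𝒵)` of
# `Ñ_{|V|−t}`, `coeff_{4·𝟙−n} Ñ_{|V|−t}(coFam 𝒳, coFam 𝒵) = coeff_n M_t(𝒳,𝒵)`, and the transfer "`M_t ∈ ℕ[s]` ⇒ `Ñ_{k−t}(K_𝒳,K_𝒵) ∈ ℕ[r]`"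

Support file (seat `prim-l12-p3`, gen 24; `--supports stmt-CriticalPhenomena-4575`).  Memo
`run/shared/lean/prim/prim-l12/FROM-prim-l12-p3-g24-VALUE-LEVEL-TH2K.md` §3 (the "duality lemma" of memo g23 §7.2, now for every level).
Companions: `…SahiCTCCoLevelDuality` (the case `t = 1`, `rev4`, `coeff_rev4_prod4`), `…SahiAtLeastOneCert` (`openFam`, `cx_eq_coFam`),
`…SahiAtLeastTwoRowA` (the slot `Th₂ᵏ`, i.e. `t = 2`, which consumes exactly `0 ≤ ev q (Ngen (k−2) (cx 𝒳) (cx 𝒵))`).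

For an "open threshold" `t` (slot: at least `t` coordinates open; certificate `ρ_{k−t}`: exactly `t` open) and families `𝒳, 𝒵` of OPEN sets put
`X_{≥t} = atLeast t 𝒳`, `X_{<t} = below t 𝒳`, `Y_{=t} = exact t (𝒳 ∩ 𝒵)` and
  `M_t(𝒳,𝒵) = e_t(Π + Θ_{<t})(Π·Y_{≥t} − X_{≥t}·Z_{≥t}) − Θ_{≥t}·Π·Θ_{<t}·Y_{=t} − e_t·Θ_{<t}(X_{≥t}Z_{<t} + X_{<t}Z_{≥t}) + e_t·Θ_{≥t}·X_{<t}Z_{<t}`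
(`Mop`, `Mop_eq`; `Mop_one_eq : M_1 = M₁` of `…SahiCTCCoLevelOne`; `M_2` is the form `M` of memo g23 §0(v) / g24 §1 whose nonnegativity — even
only at the odds vector — is the open Th₂ᵏ target).  THIS FILE: the level dictionary under member-complementation for `t ≤ |V|`
(`facesLE/facesGT/commonLE/commonEQ_coFam_gen`, `ThC/DdC/ee_level_eq`: `h ↦ X_{≥t}`, `t ↦ X_{<t}`, `e_Y ↦ Y_{=t}`, `Θ_{|V|−t} ↦ Θ_{≥t}`,
`D_{|V|−t} ↦ Θ_{<t}`, `e_{|V|−t} ↦ e_t`), `Ngen_level_eq`, **`coeff_Ngen_level_rev4`**, `coeff_Ngen_level_eq_zero`,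
**`coeff_Ngen_level_nonneg_of_Mop`**, and on the pattern cube **`coeff_Ngen_cx_nonneg_of_Mop`** / `ev_Ngen_cx_nonneg_of_Mop`:
`(∀ n, 0 ≤ coeff_n M_t(openFam 𝒳, openFam 𝒵)) → Ñ_{k−t}(K_𝒳,K_𝒵) ∈ ℕ[r]` (resp. `≥ 0` at the odds); and at the VALUE level (`profLE4`,
`eval₂_eq_of_rev4`: `P(r) = (∏ rᵢ⁴)·Q(r⁻¹)` for reversed polynomials supported on profiles `≤ 4`, `eval₂_nonneg_of_rev4`,
**`eval₂_Ngen_level_nonneg_of_Mop_pos`**, **`ev_Ngen_cx_nonneg_of_Mop_pos`**): if `M_t(openFam 𝒳, openFam 𝒵) ≥ 0` at EVERY point with positive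
entries then the (TC) row `Ñ_{k−t}(K_𝒳,K_𝒵)(r) ≥ 0` holds at the odds vector of every interior parameter vector — for `t = 2` exactly the hypothesis of
`…SahiAtLeastTwoRowA.sahiE_three_nonneg_of_atLeastTwo_of_Ngen`.  So any future proof for `Th_tᵏ`, coefficientwise OR value-level, can be written
entirely in the open-set language.  Nothing is asserted about the crux; no positivity of `M_t` is claimed for `t ≥ 2`.
-/

namespace Summit.CriticalPhenomena.PercolationContinuityZ3.Theorems.SahiCTCForms

open Finset MvPolynomial SahiCTCGenFun

variable {α : Type*} [DecidableEq α] [Fintype α]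

/-! ### Size filters of a family (open-set language) -/

/-- Members of size `≥ t`. [this work] -/
def atLeast (t : ℕ) (F : Finset (Finset α)) : Finset (Finset α) := F.filter fun S => t ≤ #S
/-- Members of size `< t`. [this work] -/
def below (t : ℕ) (F : Finset (Finset α)) : Finset (Finset α) := F.filter fun S => #S < t
/-- Members of size `= t`. [this work] -/
def exact (t : ℕ) (F : Finset (Finset α)) : Finset (Finset α) := F.filter fun S => #S = t

/-- **The open-language form `M_t(𝒳,𝒵)` of the level-`(|V|−t)` certificate polynomial** (slot "at least `t` open", certificate "exactly `t`
open"): the eight four-fold products of `Ñ_{|V|−t}` with every closed family replaced by the corresponding open family. [this work] -/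
noncomputable def Mop (t : ℕ) (F G : Finset (Finset α)) : MvPolynomial α ℤ :=
  (gf (bySize (· = t)) * gf univ.powerset) * (gf univ.powerset * gf (atLeast t (F ∩ G)))
  - (gf (bySize (· = t)) * gf univ.powerset) * (gf (atLeast t F) * gf (atLeast t G))
  + (gf (bySize (· = t)) * gf (bySize (· < t))) * (gf univ.powerset * gf (atLeast t (F ∩ G)))
  - (gf (bySize (· = t)) * gf (bySize (· < t))) * (gf (atLeast t F) * gf (atLeast t G))
  - (gf (bySize (t ≤ ·)) * gf univ.powerset) * (gf (bySize (· < t)) * gf (exact t (F ∩ G)))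
  - (gf (bySize (· = t)) * gf (bySize (· < t))) * (gf (atLeast t F) * gf (below t G))
  - (gf (bySize (· = t)) * gf (bySize (· < t))) * (gf (below t F) * gf (atLeast t G))
  + (gf (bySize (· = t)) * gf (bySize (t ≤ ·))) * (gf (below t F) * gf (below t G))

/-- `M_t` in the familiar shape `e_t(Π+Θ_{<t})(Π·Y_{≥t} − X_{≥t}Z_{≥t}) − Θ_{≥t}ΠΘ_{<t}·Y_{=t} − e_tΘ_{<t}(X_{≥t}Z_{<t} + X_{<t}Z_{≥t}) + e_tΘ_{≥t}X_{<t}Z_{<t}`. [this work] -/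
theorem Mop_eq (t : ℕ) (F G : Finset (Finset α)) : Mop t F G =
    ee t * (PiP + gf (bySize (· < t))) * (PiP * gf (atLeast t (F ∩ G)) - gf (atLeast t F) * gf (atLeast t G))
    - gf (bySize (t ≤ ·)) * PiP * gf (bySize (· < t)) * gf (exact t (F ∩ G))
    - ee t * gf (bySize (· < t)) * (gf (atLeast t F) * gf (below t G) + gf (below t F) * gf (atLeast t G))
    + ee t * gf (bySize (t ≤ ·)) * gf (below t F) * gf (below t G) := by
  unfold Mop ee PiP; ring

/-! ### The level dictionary under member-complementation (`c + t = |V|`) -/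

section Dict

variable {t : ℕ} (ht : t ≤ Fintype.card α)
include ht

omit [DecidableEq α] in
/-- `#S ≤ |V| − t ↔ t ≤ #(V ∖ S)`. [this work] -/
theorem card_le_sub_iff [DecidableEq α] (S : Finset α) : #S ≤ Fintype.card α - t ↔ t ≤ #((univ : Finset α) \ S) := by
  rw [card_univ_sdiff]; have := card_le_univ S; omega

omit [DecidableEq α] in
/-- `|V| − t < #S ↔ #(V ∖ S) < t`. [this work] -/
theorem sub_lt_card_iff [DecidableEq α] (S : Finset α) : Fintype.card α - t < #S ↔ #((univ : Finset α) \ S) < t := by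
  rw [card_univ_sdiff]; have := card_le_univ S; omega

omit [DecidableEq α] in
/-- `#S = |V| − t ↔ #(V ∖ S) = t`. [this work] -/
theorem card_eq_sub_iff [DecidableEq α] (S : Finset α) : #S = Fintype.card α - t ↔ #((univ : Finset α) \ S) = t := by
  rw [card_univ_sdiff]; have := card_le_univ S; omega

/-- `h` at level `|V|−t` = member-complements of the members of size `≥ t`. [this work] -/
theorem facesLE_coFam_gen (F : Finset (Finset α)) : facesLE (Fintype.card α - t) (coFam F) = coFam (atLeast t F) := by
  ext S; simp only [facesLE, atLeast, mem_filter, mem_powerset, subset_univ, true_and, mem_coFam, card_le_sub_iff ht]; tauto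

/-- `t` at level `|V|−t` = member-complements of the members of size `< t`. [this work] -/
theorem facesGT_coFam_gen (F : Finset (Finset α)) : facesGT (Fintype.card α - t) (coFam F) = coFam (below t F) := by
  ext S; simp only [facesGT, below, mem_filter, mem_powerset, subset_univ, true_and, mem_coFam, sub_lt_card_iff ht]; tauto

/-- `h_Y` at level `|V|−t`. [this work] -/
theorem commonLE_coFam_gen (F G : Finset (Finset α)) :
    commonLE (Fintype.card α - t) (coFam F) (coFam G) = coFam (atLeast t (F ∩ G)) := by
  ext S; simp only [commonLE, atLeast, mem_filter, mem_powerset, subset_univ, true_and, mem_coFam, mem_inter, card_le_sub_iff ht]; tauto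

/-- `e_Y` at level `|V|−t`. [this work] -/
theorem commonEQ_coFam_gen (F G : Finset (Finset α)) :
    commonEQ (Fintype.card α - t) (coFam F) (coFam G) = coFam (exact t (F ∩ G)) := by
  ext S; simp only [commonEQ, exact, mem_filter, mem_powerset, subset_univ, true_and, mem_coFam, mem_inter, card_eq_sub_iff ht]; tauto

/-- `Θ_{|V|−t} = GF(coFam (sets of size ≥ t))`. [this work] -/
theorem ThC_level_eq : (ThC (Fintype.card α - t) : MvPolynomial α ℤ) = gf (coFam (bySize (t ≤ ·) : Finset (Finset α))) := by
  unfold ThC bySize; congr 1; ext S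
  simp only [mem_filter, mem_powerset, subset_univ, true_and, mem_coFam, card_le_sub_iff ht]

/-- `D_{|V|−t} = GF(coFam (sets of size < t))`. [this work] -/
theorem DdC_level_eq : (DdC (Fintype.card α - t) : MvPolynomial α ℤ) = gf (coFam (bySize (· < t) : Finset (Finset α))) := by
  unfold DdC bySize; congr 1; ext S
  simp only [mem_filter, mem_powerset, subset_univ, true_and, mem_coFam, sub_lt_card_iff ht]

/-- `e_{|V|−t} = GF(coFam e_t)`. [this work] -/
theorem ee_level_eq : (ee (Fintype.card α - t) : MvPolynomial α ℤ) = gf (coFam (bySize (· = t) : Finset (Finset α))) := by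
  unfold ee bySize; congr 1; ext S
  simp only [mem_filter, mem_powerset, subset_univ, true_and, mem_coFam, card_eq_sub_iff ht]

end Dict

/-! ### Duality of the coefficients and transfer of nonnegativity -/

/-- `Ñ_{|V|−t}` of a pair of member-complemented families = the eight four-fold products of member-complemented open families. [this work] -/
theorem Ngen_level_eq {t : ℕ} (ht : t ≤ Fintype.card α) (F G : Finset (Finset α)) :
    Ngen (Fintype.card α - t) (coFam F) (coFam G) =
      (gf (coFam (bySize (· = t))) * gf (coFam univ.powerset)) * (gf (coFam univ.powerset) * gf (coFam (atLeast t (F ∩ G))))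
      - (gf (coFam (bySize (· = t))) * gf (coFam univ.powerset)) * (gf (coFam (atLeast t F)) * gf (coFam (atLeast t G)))
      + (gf (coFam (bySize (· = t))) * gf (coFam (bySize (· < t)))) * (gf (coFam univ.powerset) * gf (coFam (atLeast t (F ∩ G))))
      - (gf (coFam (bySize (· = t))) * gf (coFam (bySize (· < t)))) * (gf (coFam (atLeast t F)) * gf (coFam (atLeast t G)))
      - (gf (coFam (bySize (t ≤ ·))) * gf (coFam univ.powerset)) * (gf (coFam (bySize (· < t))) * gf (coFam (exact t (F ∩ G))))
      - (gf (coFam (bySize (· = t))) * gf (coFam (bySize (· < t)))) * (gf (coFam (atLeast t F)) * gf (coFam (below t G)))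
      - (gf (coFam (bySize (· = t))) * gf (coFam (bySize (· < t)))) * (gf (coFam (below t F)) * gf (coFam (atLeast t G)))
      + (gf (coFam (bySize (· = t))) * gf (coFam (bySize (t ≤ ·)))) * (gf (coFam (below t F)) * gf (coFam (below t G))) := by
  unfold Ngen
  rw [facesLE_coFam_gen ht, facesLE_coFam_gen ht, facesGT_coFam_gen ht, facesGT_coFam_gen ht, commonLE_coFam_gen ht, commonEQ_coFam_gen ht,
    ThC_level_eq ht, DdC_level_eq ht, ee_level_eq ht, PiP_eq_gf_coFam]
  ring

/-- **Coefficient duality**: `coeff_{4𝟙−n}(Ñ_{|V|−t}(coFam 𝒳, coFam 𝒵)) = coeff_n(M_t(𝒳,𝒵))` for `n ≤ 4`. [this work] -/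
theorem coeff_Ngen_level_rev4 {t : ℕ} (ht : t ≤ Fintype.card α) (F G : Finset (Finset α)) {n : α →₀ ℕ} (hn : ∀ i, n i ≤ 4) :
    (Ngen (Fintype.card α - t) (coFam F) (coFam G)).coeff (rev4 n) = (Mop t F G).coeff n := by
  rw [Ngen_level_eq ht]
  unfold Mop
  simp only [coeff_add, coeff_sub, coeff_rev4_prod4 _ _ _ _ hn]

/-- Profiles with an entry `> 4` carry no coefficient of `Ñ_{|V|−t}(coFam 𝒳, coFam 𝒵)`. [this work] -/
theorem coeff_Ngen_level_eq_zero {t : ℕ} (ht : t ≤ Fintype.card α) (F G : Finset (Finset α)) {m : α →₀ ℕ} (hm : ¬ ∀ i, m i ≤ 4) :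
    (Ngen (Fintype.card α - t) (coFam F) (coFam G)).coeff m = 0 := by
  rw [Ngen_level_eq ht]
  simp only [coeff_add, coeff_sub, coeff_prod4_eq_zero _ _ _ _ hm, sub_zero, add_zero]

/-- **TRANSFER**: if the open-language form `M_t(𝒳,𝒵)` has nonnegative coefficients then so has `Ñ_{|V|−t}(coFam 𝒳, coFam 𝒵)`. [this work] -/
theorem coeff_Ngen_level_nonneg_of_Mop {t : ℕ} (ht : t ≤ Fintype.card α) {F G : Finset (Finset α)} (hM : ∀ n, 0 ≤ (Mop t F G).coeff n) :
    ∀ m, 0 ≤ (Ngen (Fintype.card α - t) (coFam F) (coFam G)).coeff m := by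
  intro m
  by_cases hm : ∀ i, m i ≤ 4
  · rw [← rev4_rev4 hm, coeff_Ngen_level_rev4 ht F G (rev4_le_four m)]; exact hM _
  · rw [coeff_Ngen_level_eq_zero ht F G hm]

/-- **Consistency at `t = 1`**: `M_1 = M₁` of `…SahiCTCCoLevelOne`. [this work] -/
theorem Mop_one_eq (F G : Finset (Finset α)) : Mop 1 F G = M1 F G := by
  have h1 : ∀ K : Finset (Finset α), atLeast 1 K = K.erase ∅ := fun K => by
    ext S; simp only [atLeast, mem_filter, mem_erase, Nat.one_le_iff_ne_zero, ne_eq, card_eq_zero]; tauto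
  have h2 : ∀ K : Finset (Finset α), below 1 K = empPart K := fun K => by
    ext S; simp only [below, empPart, mem_filter, Nat.lt_one_iff, card_eq_zero]
  have h3 : exact 1 (F ∩ G) = singles (loops F G) := by
    ext S; simp only [exact, mem_filter, mem_inter, mem_singles, loops, mem_univ, true_and, card_eq_one]
    constructor
    · rintro ⟨⟨hF, hG⟩, u, rfl⟩; exact ⟨u, ⟨hF, hG⟩, rfl⟩
    · rintro ⟨u, ⟨hF, hG⟩, rfl⟩; exact ⟨⟨hF, hG⟩, u, rfl⟩
  have h4 : (bySize (· < 1) : Finset (Finset α)) = {∅} := by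
    unfold bySize; ext S; simp only [mem_filter, mem_powerset, subset_univ, true_and, Nat.lt_one_iff, card_eq_zero, mem_singleton]
  have h5 : (bySize (1 ≤ ·) : Finset (Finset α)) = univ.powerset.erase ∅ := by
    unfold bySize; ext S; simp only [mem_filter, mem_powerset, subset_univ, true_and, mem_erase, Nat.one_le_iff_ne_zero, ne_eq, card_eq_zero]; tauto
  rw [M1_eq_prod4]; unfold Mop
  rw [h1, h1, h1, h2, h2, h3, h4, h5]

/-! ### Reversal at the VALUE level: `P(r) = (∏ rᵢ⁴)·Q(1/r)` -/

/-- The finset of all profiles `≤ 4` pointwise. [this work] -/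
noncomputable def profLE4 : Finset (α →₀ ℕ) :=
  (Fintype.piFinset fun _ : α => Finset.range 5).map Finsupp.equivFunOnFinite.symm.toEmbedding

/-- Membership in `profLE4`. [this work] -/
theorem mem_profLE4 {m : α →₀ ℕ} : m ∈ (profLE4 : Finset (α →₀ ℕ)) ↔ ∀ i, m i ≤ 4 := by
  unfold profLE4
  rw [Finset.mem_map]
  constructor
  · rintro ⟨f, hf, rfl⟩
    intro i
    have := Fintype.mem_piFinset.1 hf i
    rw [Finset.mem_range] at this
    show Finsupp.equivFunOnFinite.symm f i ≤ 4
    rw [Finsupp.coe_equivFunOnFinite_symm]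
    omega
  · intro h
    refine ⟨fun i => m i, Fintype.mem_piFinset.2 fun i => Finset.mem_range.2 (by have := h i; omega), ?_⟩
    ext i
    show Finsupp.equivFunOnFinite.symm (fun i => m i) i = m i
    rw [Finsupp.coe_equivFunOnFinite_symm]

/-- Evaluation as a sum over all profiles `≤ 4`, for a polynomial supported there. [this work] -/
theorem eval₂_eq_sum_profLE4 {P : MvPolynomial α ℤ} (hP : ∀ m, ¬ (∀ i, m i ≤ 4) → P.coeff m = 0) (x : α → ℝ) :
    eval₂ (Int.castRingHom ℝ) x P = ∑ d ∈ (profLE4 : Finset (α →₀ ℕ)), ((P.coeff d : ℤ) : ℝ) * ∏ i, x i ^ d i := by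
  rw [eval₂_eq']
  have hsub : P.support ⊆ profLE4 := by
    intro m hm
    rw [mem_profLE4]
    by_contra h
    exact (mem_support_iff.1 hm) (hP m h)
  rw [Finset.sum_subset hsub (fun d _ hd => by rw [notMem_support_iff.1 hd]; simp)]
  refine Finset.sum_congr rfl fun d _ => ?_
  rw [eq_intCast]

/-- **Value-level reversal**: if `coeff_{4𝟙−n} P = coeff_n Q` for all profiles `n ≤ 4` and neither polynomial has coefficients at other profiles,
then `P(r) = (∏ᵢ rᵢ⁴)·Q(r⁻¹)` at every `r` with nonzero entries. [this work] -/
theorem eval₂_eq_of_rev4 {P Q : MvPolynomial α ℤ} (hPQ : ∀ n : α →₀ ℕ, (∀ i, n i ≤ 4) → P.coeff (rev4 n) = Q.coeff n)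
    (hP : ∀ m, ¬ (∀ i, m i ≤ 4) → P.coeff m = 0) (hQ : ∀ m, ¬ (∀ i, m i ≤ 4) → Q.coeff m = 0) (r : α → ℝ) (hr : ∀ i, r i ≠ 0) :
    eval₂ (Int.castRingHom ℝ) r P = (∏ i, r i ^ 4) * eval₂ (Int.castRingHom ℝ) (fun i => (r i)⁻¹) Q := by
  rw [eval₂_eq_sum_profLE4 hP, eval₂_eq_sum_profLE4 hQ, Finset.mul_sum]
  refine Finset.sum_nbij' rev4 rev4 (fun m _ => mem_profLE4.2 (rev4_le_four m)) (fun n _ => mem_profLE4.2 (rev4_le_four n))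
    (fun m hm => rev4_rev4 (mem_profLE4.1 hm)) (fun n hn => rev4_rev4 (mem_profLE4.1 hn)) (fun m hm => ?_)
  have hm4 := mem_profLE4.1 hm
  have hcoef : P.coeff m = Q.coeff (rev4 m) := by
    have := hPQ (rev4 m) (rev4_le_four m); rwa [rev4_rev4 hm4] at this
  have key : ∀ i, r i ^ 4 * (r i)⁻¹ ^ (rev4 m i) = r i ^ m i := by
    intro i
    rw [rev4_apply]
    have h4 : r i ^ 4 = r i ^ m i * r i ^ (4 - m i) := by rw [← pow_add]; congr 1; have := hm4 i; omega
    rw [h4, mul_assoc, ← mul_pow, mul_inv_cancel₀ (hr i), one_pow, mul_one]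
  calc ((P.coeff m : ℤ) : ℝ) * ∏ i, r i ^ m i = ((Q.coeff (rev4 m) : ℤ) : ℝ) * ∏ i, (r i ^ 4 * (r i)⁻¹ ^ rev4 m i) := by
        rw [hcoef]; exact congrArg _ (Finset.prod_congr rfl fun i _ => (key i).symm)
    _ = (∏ i, r i ^ 4) * (((Q.coeff (rev4 m) : ℤ) : ℝ) * ∏ i, (r i)⁻¹ ^ rev4 m i) := by rw [Finset.prod_mul_distrib]; ring

/-- Hence: if `Q ≥ 0` at every point with positive entries, so is `P`. [this work] -/
theorem eval₂_nonneg_of_rev4 {P Q : MvPolynomial α ℤ} (hPQ : ∀ n : α →₀ ℕ, (∀ i, n i ≤ 4) → P.coeff (rev4 n) = Q.coeff n)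
    (hP : ∀ m, ¬ (∀ i, m i ≤ 4) → P.coeff m = 0) (hQ : ∀ m, ¬ (∀ i, m i ≤ 4) → Q.coeff m = 0)
    (hQpos : ∀ x : α → ℝ, (∀ i, 0 < x i) → 0 ≤ eval₂ (Int.castRingHom ℝ) x Q) (r : α → ℝ) (hr : ∀ i, 0 < r i) :
    0 ≤ eval₂ (Int.castRingHom ℝ) r P := by
  rw [eval₂_eq_of_rev4 hPQ hP hQ r (fun i => (hr i).ne')]
  exact mul_nonneg (Finset.prod_nonneg fun i _ => pow_nonneg (hr i).le _) (hQpos _ fun i => inv_pos.2 (hr i))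

/-- `M_t` has no coefficient at a profile with an entry `> 4`. [this work] -/
theorem coeff_Mop_eq_zero (t : ℕ) (F G : Finset (Finset α)) {m : α →₀ ℕ} (hm : ¬ ∀ i, m i ≤ 4) : (Mop t F G).coeff m = 0 := by
  unfold Mop
  simp only [coeff_add, coeff_sub, coeff_prod4_eq_zero _ _ _ _ hm, sub_zero, add_zero]

/-- **VALUE-LEVEL TRANSFER**: if the open-language form `M_t(𝒳,𝒵)` is `≥ 0` at every point with positive entries, then
`Ñ_{|V|−t}(coFam 𝒳, coFam 𝒵)` is `≥ 0` at every point with positive entries. [this work] -/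
theorem eval₂_Ngen_level_nonneg_of_Mop_pos {t : ℕ} (ht : t ≤ Fintype.card α) {F G : Finset (Finset α)}
    (hM : ∀ x : α → ℝ, (∀ i, 0 < x i) → 0 ≤ eval₂ (Int.castRingHom ℝ) x (Mop t F G)) (r : α → ℝ) (hr : ∀ i, 0 < r i) :
    0 ≤ eval₂ (Int.castRingHom ℝ) r (Ngen (Fintype.card α - t) (coFam F) (coFam G)) :=
  eval₂_nonneg_of_rev4 (fun _ hn => coeff_Ngen_level_rev4 ht F G hn) (fun _ hm => coeff_Ngen_level_eq_zero ht F G hm)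
    (fun _ hm => coeff_Mop_eq_zero t F G hm) hM r hr

end Summit.CriticalPhenomena.PercolationContinuityZ3.Theorems.SahiCTCForms

/-! ### On the pattern cube -/

noncomputable section

open scoped Classical

namespace Summit.CriticalPhenomena.PercolationContinuityZ3.Theorems

namespace SahiAllButC

open Finset MvPolynomial
open SahiHittingSlot SahiTransportCert SahiAllButOne SahiAllButTwo SahiCTCForms SahiCTCGenFun SahiCTCWeightedLYM

variable {k : ℕ}

/-- **TRANSFER ON THE PATTERN CUBE**: for `t ≤ k`, if the open-language form `M_t(𝒳,𝒵)` has nonnegative coefficients for the open families of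
two events `𝒳, 𝒵`, then `Ñ_{k−t}(K_𝒳,K_𝒵) ∈ ℕ[r]` — the hypothesis of `…SahiAllButC.rhoCert_allBut` for the slot "at least `t` of `k` open"
(in particular `t = 2`: the slot `Th₂ᵏ` of `…SahiAtLeastTwoRowA`). [this work] -/
theorem coeff_Ngen_cx_nonneg_of_Mop {t : ℕ} (ht : t ≤ k) {𝒳 𝒵 : Set (Set (Fin k))}
    (hM : ∀ n, 0 ≤ (Mop t (openFam 𝒳) (openFam 𝒵)).coeff n) : ∀ m, 0 ≤ (Ngen (k - t) (cx 𝒳) (cx 𝒵)).coeff m := by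
  have ht' : t ≤ Fintype.card (Fin k) := by rw [Fintype.card_fin]; exact ht
  have h := coeff_Ngen_level_nonneg_of_Mop ht' hM
  rw [Fintype.card_fin] at h
  rw [cx_eq_coFam, cx_eq_coFam]; exact h

/-- The same at the odds vector: the (TC) row of `ρ_{k−t}` follows from `M_t ∈ ℕ[s]` for the open families. [this work] -/
theorem ev_Ngen_cx_nonneg_of_Mop {t : ℕ} (ht : t ≤ k) {q : Fin k → unitInterval} (hq : ∀ i, 0 < (q i : ℝ) ∧ (q i : ℝ) < 1)
    {𝒳 𝒵 : Set (Set (Fin k))} (hM : ∀ n, 0 ≤ (Mop t (openFam 𝒳) (openFam 𝒵)).coeff n) : 0 ≤ ev q (Ngen (k - t) (cx 𝒳) (cx 𝒵)) := by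
  have h := eval_le_of_coeff_le (P := (0 : MvPolynomial (Fin k) ℤ)) (Q := Ngen (k - t) (cx 𝒳) (cx 𝒵))
    (fun m => by rw [coeff_zero]; exact coeff_Ngen_cx_nonneg_of_Mop ht hM m) (r q) (r_nonneg hq)
  rw [eval₂_zero] at h; exact h

/-- **VALUE-LEVEL TRANSFER ON THE PATTERN CUBE**: if `M_t(openFam 𝒳, openFam 𝒵)` is `≥ 0` at every point with positive entries (e.g. at every odds
vector of interior parameters), then the (TC) row `Ñ_{k−t}(K_𝒳,K_𝒵)(r) ≥ 0` holds at the odds vector of every interior parameter vector — for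
`t = 2` this is exactly the hypothesis `hN` of `…SahiAtLeastTwoRowA.sahiE_three_nonneg_of_atLeastTwo_of_Ngen`. [this work] -/
theorem ev_Ngen_cx_nonneg_of_Mop_pos {t : ℕ} (ht : t ≤ k) {q : Fin k → unitInterval} (hq : ∀ i, 0 < (q i : ℝ) ∧ (q i : ℝ) < 1)
    {𝒳 𝒵 : Set (Set (Fin k))} (hM : ∀ x : Fin k → ℝ, (∀ i, 0 < x i) → 0 ≤ eval₂ (Int.castRingHom ℝ) x (Mop t (openFam 𝒳) (openFam 𝒵))) :
    0 ≤ ev q (Ngen (k - t) (cx 𝒳) (cx 𝒵)) := by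
  have ht' : t ≤ Fintype.card (Fin k) := by rw [Fintype.card_fin]; exact ht
  have h := eval₂_Ngen_level_nonneg_of_Mop_pos ht' hM (r q) (r_pos hq)
  rw [Fintype.card_fin] at h
  unfold ev
  rw [cx_eq_coFam, cx_eq_coFam]; exact h

end SahiAllButC

end Summit.CriticalPhenomena.PercolationContinuityZ3.Theorems
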